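import Summits.QuantumFields.BalabanUV.T4Continuum.Support.NE7CombLineSumGramBounds
import Summits.QuantumFields.BalabanUV.T4Continuum.Support.NE3HilbertSchmidtTorus
import Summits.QuantumFields.BalabanUV.T4Continuum.Support.NE7AdjointGramCoercivity
import Mathlib.Analysis.InnerProductSpace.Adjoint

/-!
# NE7CombLineSumCoercive — (α_S) ON THE HILBERT–SCHMIDT TORUS 1-FORMS: the κ-last comb line sum `TWg M (combFrame W M)` as a continuous linear map
# `S : Form d n (M·N) →L[ℝ] Form d n N`, its adjoint `S† = resF ∘ WadWg M (combFrame W M) ∘ extF` (K4-a's torus identity), and — at ANY unitary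
# `(M·N)`-periodic background `W` — `λ`-COERCIVITY ON `(ker S)ᗮ` with `λ = M^{d−1}·M(M²+2)∕3` and `‖S v‖ ≤ √(M^{d−1}·M³)·‖v‖` (`Λ²∕λ = 3M²∕(M²+2) ≤ 3`)

Cell `pub-balaban`, rung (B)+1 sub-cell t4, lineage `b2b-balaban-t4-ne7-p1`, generation 63 (CRUX PROVER NE7 #1, ruling e34b3e0c (2)); hunt (h7)
«ENERGY ROAD», memo v2 §6; companion of `NE7CombLineSumGramBounds` (this generation: the two-sided Gram bound of `WadWg M (combFrame W M)` in lattice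
currency, exact at any unitary background) and consumer-side twin of gen 62's `NE7AdjointGramCoercivity` (`coercive_of_adjoint_lower_bound`,
`opNorm_le_of_adjoint_upper_bound`).  CONTENT ([folklore]; 0 def, 0 sorry): `TWg_add_fun` ∕ `TWg_smul_fun` ∕ `resF_smul` (linearity),
**`exists_combLineSum_clm`** (`∃ S, S η = resF N (TWg M (combFrame W M) (extF (M·N) η))` — existence, no def), **`adjoint_combLineSum_apply`**
(`S† ω = resF (M·N) (WadWg M (combFrame W M) (extF N ω))`, from `NE3CovariantLineAdjoint.sum_hsR_TWg_eq_sum_hsR_WadWg` BY NAME), `norm_sq_adjoint_combLineSum`,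
**`combLineSum_adjoint_lower`** ∕ **`combLineSum_adjoint_upper`** (`λ‖μ‖² ≤ ‖S†μ‖² ≤ Λ²‖μ‖²`, `λ = M^{d−1}·M(M²+2)∕3`, `Λ² = M^{d−1}·M³` — the form that survives an
adjoint perturbation `S ↦ S + E`),
**`combLineSum_coercive`** (`M^{d−1}·M(M²+2)∕3·‖v‖² ≤ ‖S v‖²` on `(ker S)ᗮ`) and **`combLineSum_norm_le`** (`‖S v‖ ≤ √(M^{d−1}·M³)·‖v‖`): EXACTLY the
hypotheses `hcoer`, `hS` of `NE7TensionKernelCoercivity.normSq_le_of_exact_annihilator` for THIS `S`, at a curved background, with no smallness.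
WHAT REMAINS for (E3″) after this file: (β_S) for the same `S` (comb-gauge transverse telescoping of the covariant divergence datum), the perturbation
`‖QbarIter k W − M^{−d}•TWc‖` (NE3 C1 tower files), the identification (h7-e), (8) interiority.
HONEST FRAMING (page 1): finite-dimensional linear algebra on the NE3 swarm's typed objects at ONE unitary background; nothing about Bałaban's
minimisers; NE7, NE3 NOT PRINTED in [Balaban1984PropagatorsI]–[Balaban1989LargeFieldII] and NOT PROVED; FIXED FINITE torus, rung (B)+1; continuum YM on
T⁴ ⇐ BetaPertH ∧ nine spine estimates (0/9 proved); BetaPertH ⇐ (D1) ∧ (D4) ∧ CAP+tail; G-an2-4 gates asym, D1 and NE2/3/4; NOT infinite volume, NOT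
mass gap, NOT Clay.
-/

set_option autoImplicit false

open scoped BigOperators InnerProductSpace Matrix Matrix.Norms.L2Operator
open Finset

namespace Summit.QuantumFields.BalabanUV.T4Continuum.NE7CombLineSumCoercive

open Literature.MathematicalPhysics.QuantumFieldTheory.Balaban1983to89
open B7Prop1Explicit B7Prop2Explicit MatrixNorms UnitaryModel
open T4AveragingDeficitWall (IsUnitaryCfg Ad)
open T4AveragingDeficitWallBoundary (periodBox IsPeriodicCfg)
open AveragingDeficitNearIdentity (Ad_add Ad_real_smul)
open NE3CovariantLineAdjoint
open NE3HilbertSchmidtTorus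
open NE7AdjointGramCoercivity (coercive_of_adjoint_lower_bound opNorm_le_of_adjoint_upper_bound)
open NE7CombLineSumGramBounds (sum_nhsNormSq_WadWg_combFrame_lower sum_nhsNormSq_WadWg_combFrame_upper)

noncomputable section

variable {d : ℕ} {n : Type*} [Fintype n] [DecidableEq n]

/-! ## The comb line sum as a continuous linear map, its adjoint, its coercivity and norm -/

/-- `TWg` is additive in the fine field. [folklore] -/
theorem TWg_add_fun (M : ℕ) (g : Site d → Fin d → Site d → ℕ → (Matrix n n ℂ)ˣ) (η η' : Site d → Fin d → Matrix n n ℂ) :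
    TWg M g (fun y μ => η y μ + η' y μ) = fun z κ => TWg M g η z κ + TWg M g η' z κ := by
  funext z κ
  simp only [TWg, Ad_add, Finset.sum_add_distrib]

/-- `TWg` commutes with real scalars. [folklore] -/
theorem TWg_smul_fun (M : ℕ) (g : Site d → Fin d → Site d → ℕ → (Matrix n n ℂ)ˣ) (t : ℝ) (η : Site d → Fin d → Matrix n n ℂ) :
    TWg M g (fun y μ => t • η y μ) = fun z κ => t • TWg M g η z κ := by
  funext z κ
  simp only [TWg, Ad_real_smul, Finset.smul_sum]

omit [Fintype n] [DecidableEq n] in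
/-- `resF` commutes with real scalars. [folklore] -/
theorem resF_smul (P : ℕ) (t : ℝ) (Y : Site d → Fin d → Matrix n n ℂ) :
    resF P (fun x κ => t • Y x κ) = t • resF (d := d) P Y := by
  ext p : 1; rfl

/-- **THE COMB LINE SUM AS A CONTINUOUS LINEAR MAP** from the fine torus 1-forms (period `M·N`) to the coarse ones (period `N`):
`S η = resF N (TWg M (combFrame W M) (extF (M·N) η))` (existence; no def). [folklore] -/
theorem exists_combLineSum_clm (M N : ℕ) [NeZero N] [NeZero (M * N)] (W : Site d → Fin d → (Matrix n n ℂ)ˣ) :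
    ∃ S : Form d n (M * N) →L[ℝ] Form d n N, ∀ η : Form d n (M * N), S η = resF N (TWg M (combFrame W M) (extF (M * N) η)) := by
  let T : Form d n (M * N) →ₗ[ℝ] Form d n N :=
    { toFun := fun η => resF N (TWg M (combFrame W M) (extF (M * N) η))
      map_add' := fun a b => by
        have h : extF (M * N) (a + b) = fun y μ => extF (M * N) a y μ + extF (M * N) b y μ := rfl
        simp only [h, TWg_add_fun, resF_add]
      map_smul' := fun t a => by
        have h : extF (M * N) (t • a) = fun y μ => t • extF (M * N) a y μ := rfl
        simp only [h, TWg_smul_fun, resF_smul, RingHom.id_apply] }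
  exact ⟨LinearMap.toContinuousLinearMap T, fun η => rfl⟩

/-- **ITS ADJOINT IS THE TRANSPORTED LONGITUDINAL INTERPOLATION** (K4-a's torus identity `sum_hsR_TWg_eq_sum_hsR_WadWg`): for unitary
`(M·N)`-periodic `W`, `S† ω = resF (M·N) (WadWg M (combFrame W M) (extF N ω))`. [folklore] -/
theorem adjoint_combLineSum_apply {M N : ℕ} [NeZero N] [NeZero (M * N)] (hM : 1 ≤ M) (hN : 1 ≤ N)
    {W : Site d → Fin d → (Matrix n n ℂ)ˣ} (hW : IsUnitaryCfg W) (hWP : IsPeriodicCfg W ((M * N : ℕ) : ℤ))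
    (S : Form d n (M * N) →L[ℝ] Form d n N) (hS : ∀ η : Form d n (M * N), S η = resF N (TWg M (combFrame W M) (extF (M * N) η)))
    (ω : Form d n N) :
    ContinuousLinearMap.adjoint S ω = resF (M * N) (WadWg M (combFrame W M) (extF N ω)) := by
  refine ext_inner_right ℝ fun η => ?_
  rw [ContinuousLinearMap.adjoint_inner_left, hS]
  conv_lhs => rw [← resF_extF N ω]
  conv_rhs => rw [← resF_extF (M * N) η]
  rw [inner_resF, inner_resF]
  exact sum_hsR_TWg_eq_sum_hsR_WadWg hM hN (combFrame W M) (fun z κ v i => combFrame_mem hW M z κ v i)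
    (fun z τ κ v i => combFrame_add_period hWP z τ κ v i) (extF N ω) (extF (M * N) η) (isPeriodicDir_extF N ω)
    (isPeriodicDir_extF (M * N) η)

/-- `‖S† ω‖² = Σ_{x∈periodBox (M·N)}Σ_κ nhsNormSq (WadWg M (combFrame W M) (extF N ω) x κ)`. [folklore] -/
theorem norm_sq_adjoint_combLineSum {M N : ℕ} [NeZero N] [NeZero (M * N)] (hM : 1 ≤ M) (hN : 1 ≤ N)
    {W : Site d → Fin d → (Matrix n n ℂ)ˣ} (hW : IsUnitaryCfg W) (hWP : IsPeriodicCfg W ((M * N : ℕ) : ℤ))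
    (S : Form d n (M * N) →L[ℝ] Form d n N) (hS : ∀ η : Form d n (M * N), S η = resF N (TWg M (combFrame W M) (extF (M * N) η)))
    (ω : Form d n N) :
    ‖ContinuousLinearMap.adjoint S ω‖ ^ 2
      = ∑ x ∈ periodBox (d := d) (M * N), ∑ κ : Fin d, nhsNormSq (WadWg M (combFrame W M) (extF N ω) x κ) := by
  rw [adjoint_combLineSum_apply hM hN hW hWP S hS ω, norm_sq_resF]

/-- **THE LOWER GRAM BOUND OF THE ADJOINT** (the form consumed by adjoint-perturbation arguments): `M^{d−1}·M(M²+2)∕3·‖μ‖² ≤ ‖S† μ‖²` for EVERY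
coarse torus 1-form `μ`, at any unitary `(M·N)`-periodic background. [folklore] -/
theorem combLineSum_adjoint_lower {M N : ℕ} [NeZero N] [NeZero (M * N)] (hM : 1 ≤ M) (hN : 1 ≤ N)
    {W : Site d → Fin d → (Matrix n n ℂ)ˣ} (hW : IsUnitaryCfg W) (hWP : IsPeriodicCfg W ((M * N : ℕ) : ℤ))
    (S : Form d n (M * N) →L[ℝ] Form d n N) (hS : ∀ η : Form d n (M * N), S η = resF N (TWg M (combFrame W M) (extF (M * N) η)))
    (μ : Form d n N) :
    (M : ℝ) ^ (d - 1) * ((M : ℝ) * ((M : ℝ) ^ 2 + 2) / 3) * ‖μ‖ ^ 2 ≤ ‖ContinuousLinearMap.adjoint S μ‖ ^ 2 := by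
  rw [norm_sq_adjoint_combLineSum hM hN hW hWP S hS μ, norm_sq_eq_sum_extF N μ]
  exact sum_nhsNormSq_WadWg_combFrame_lower hM hN hW (extF N μ) (isPeriodicDir_extF N μ)

/-- **THE UPPER GRAM BOUND OF THE ADJOINT**: `‖S† μ‖² ≤ M^{d−1}·M³·‖μ‖²`. [folklore] -/
theorem combLineSum_adjoint_upper {M N : ℕ} [NeZero N] [NeZero (M * N)] (hM : 1 ≤ M) (hN : 1 ≤ N)
    {W : Site d → Fin d → (Matrix n n ℂ)ˣ} (hW : IsUnitaryCfg W) (hWP : IsPeriodicCfg W ((M * N : ℕ) : ℤ))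
    (S : Form d n (M * N) →L[ℝ] Form d n N) (hS : ∀ η : Form d n (M * N), S η = resF N (TWg M (combFrame W M) (extF (M * N) η)))
    (μ : Form d n N) :
    ‖ContinuousLinearMap.adjoint S μ‖ ^ 2 ≤ (M : ℝ) ^ (d - 1) * (M : ℝ) ^ 3 * ‖μ‖ ^ 2 := by
  rw [norm_sq_adjoint_combLineSum hM hN hW hWP S hS μ, norm_sq_eq_sum_extF N μ]
  exact sum_nhsNormSq_WadWg_combFrame_upper hM hN hW (extF N μ) (isPeriodicDir_extF N μ)

/-- **(α_S) ON THE TORUS 1-FORMS — COERCIVITY OF THE COMB LINE SUM ON THE ORTHOCOMPLEMENT OF ITS KERNEL, AT ANY UNITARY BACKGROUND**: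
`M^{d−1}·M(M²+2)∕3·‖v‖² ≤ ‖S v‖²` for every `v ∈ (ker S)ᗮ` (hypothesis `hcoer` of `NE7TensionKernelCoercivity.normSq_le_of_exact_annihilator` for
THIS `S`). [folklore] -/
theorem combLineSum_coercive {M N : ℕ} [NeZero N] [NeZero (M * N)] (hM : 1 ≤ M) (hN : 1 ≤ N)
    {W : Site d → Fin d → (Matrix n n ℂ)ˣ} (hW : IsUnitaryCfg W) (hWP : IsPeriodicCfg W ((M * N : ℕ) : ℤ))
    (S : Form d n (M * N) →L[ℝ] Form d n N) (hS : ∀ η : Form d n (M * N), S η = resF N (TWg M (combFrame W M) (extF (M * N) η))) :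
    ∀ v : Form d n (M * N), v ∈ (LinearMap.ker (S : Form d n (M * N) →ₗ[ℝ] Form d n N))ᗮ →
      (M : ℝ) ^ (d - 1) * ((M : ℝ) * ((M : ℝ) ^ 2 + 2) / 3) * ‖v‖ ^ 2 ≤ ‖S v‖ ^ 2 := by
  have hM0 : (0 : ℝ) < M := by exact_mod_cast hM
  have hlam : 0 < (M : ℝ) ^ (d - 1) * ((M : ℝ) * ((M : ℝ) ^ 2 + 2) / 3) := by positivity
  exact coercive_of_adjoint_lower_bound S hlam (combLineSum_adjoint_lower hM hN hW hWP S hS)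

/-- **THE NORM OF THE COMB LINE SUM**: `‖S v‖ ≤ √(M^{d−1}·M³)·‖v‖` for every `v` (hypothesis `hS` of `normSq_le_of_exact_annihilator`, with
`Λ² = M^{d−1}·M³`, `Λ²∕λ = 3M²∕(M²+2) ≤ 3`). [folklore] -/
theorem combLineSum_norm_le {M N : ℕ} [NeZero N] [NeZero (M * N)] (hM : 1 ≤ M) (hN : 1 ≤ N)
    {W : Site d → Fin d → (Matrix n n ℂ)ˣ} (hW : IsUnitaryCfg W) (hWP : IsPeriodicCfg W ((M * N : ℕ) : ℤ))
    (S : Form d n (M * N) →L[ℝ] Form d n N) (hS : ∀ η : Form d n (M * N), S η = resF N (TWg M (combFrame W M) (extF (M * N) η))) :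
    ∀ v : Form d n (M * N), ‖S v‖ ≤ Real.sqrt ((M : ℝ) ^ (d - 1) * (M : ℝ) ^ 3) * ‖v‖ := by
  refine opNorm_le_of_adjoint_upper_bound S (Real.sqrt_nonneg _) fun μ => ?_
  rw [Real.sq_sqrt (by positivity)]
  exact combLineSum_adjoint_upper hM hN hW hWP S hS μ

end

end Summit.QuantumFields.BalabanUV.T4Continuum.NE7CombLineSumCoercive
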